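import Mathlib
import HarnessLib
import Literature.Combinatorics.SimpleGraph.ChordalGraph
import Literature.LinearAlgebra.Matrix.ChordalEliminationTree
import Literature.Combinatorics.SimpleGraph.ChordalTreeDecomposition

/-!
# Graph elimination: the elimination graph of an ordered graph, fill paths, elimination width
(Vandenberghe–Andersen 2015, Ch. 6: §6.1 eq. (6.1) and Theorem 6.1 (= Rose–Tarjan–Lueker 1976,
Lemma 4); §6.6: the treewidth as the least elimination width)

Sequel of `Literature.Combinatorics.SimpleGraph.ChordalGraph` (chordal = has a perfect
elimination ordering) and `Literature.Combinatorics.SimpleGraph.ChordalTreeDecomposition`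
(the tree decomposition of a perfect elimination ordering; `tw(G) = min ω(H) - 1` over chordal
supergraphs). Vertex type `V` with an order (`LT` / `LinearOrder`); "monotone transitive"
(`Literature.LinearAlgebra.Matrix.ChordalSparsity.MonotoneTransitive`, [VA15, (4.2)]) = every
higher neighbourhood `adj⁺(v)` is complete = the order is a perfect elimination ordering.

## Contents

* `elimGraph G` — **THE ELIMINATION GRAPH `G*_σ`** (filled graph, monotone transitive extension,
  [VA15, §6.1]): the least monotone transitive supergraph of `G` on the same vertices (defined as
  the infimum of all of them; [VA15, (6.1)] builds it by the elimination game, and Theorem 6.1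
  identifies the two constructions); `le_elimGraph`, `elimGraph_le` (minimality),
  `monotoneTransitive_elimGraph` (the order is a perfect elimination ordering of `G*_σ`),
  `elimGraph_eq_self_iff` (**graph elimination adds no edge iff the order is a perfect
  elimination ordering of `G`**), `elimGraph_mono`, `elimGraph_elimGraph`, `isChordal_elimGraph`
  (a chordal extension of `G`).
* `LowerWalk G v w` — a walk from `v` to `w` whose other vertices precede both `v` and `w`;
  `lowerWalkGraph`; **`elimGraph_adj_iff` = [VA15, THEOREM 6.1] (Rose–Tarjan–Lueker, Lemma 4):
  `{v,w} ∈ E*_σ` iff `G` has a `v`–`w` path with all interior vertices preceding `v` and `w`**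
  ("⇒": the lower-walk relation is a monotone transitive supergraph; "⇐" `adj_of_isPath_lower`:
  split a lower path at its HIGHEST interior vertex and use monotone transitivity there —
  induction on the length); `elimGraph_eq_lowerWalkGraph`.
* `elimWidth G = max_v deg⁺_*(v)` — the elimination width of the ordering;
  `treewidth_le_elimWidth` (every ordering: the cliques `col_*(v)` of `G*_σ` are the bags of a
  tree decomposition of `G`); `elimWidth_lt_cliqueNum_of_le` (in a perfect elimination ordering of
  a supergraph `H`, the width is `≤ ω(H) - 1`); `elimWidth_eq_treewidth_of_monotoneTransitive`;
  `IsChordal.exists_linearOrder_elimGraph_le` (every chordal supergraph contains an elimination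
  graph); `exists_linearOrder_elimWidth_eq_treewidth` and **`isLeast_treewidth_elimWidth` =
  [VA15, §6.6, p. 310]: "the minimum value of `max_v deg⁺_*(v)`, over all possible orderings, is
  known as the treewidth of `G`"** (via [Diestel, Cor. 12.3.9] of `ChordalTreeDecomposition`).

NOT here: the step-by-step elimination game (6.1) as a recursion and the elimination tree of a
non-chordal pattern ([VA15, §6.2]); fill-in counts `|E*_σ \ E|`, minimum / minimal orderings and
their NP-completeness / algorithms ([VA15, §6.6], Yannakakis, Rose–Tarjan–Lueker, MCS-M);
clique trees of `G*_σ` from supernodes ([VA15, §6.3–6.5]).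

## References (keys of `lean/references.bib`)

* [VA15] L. Vandenberghe, M. S. Andersen, *Chordal Graphs and Semidefinite Optimization*, Found.
  Trends Optim. 1(4) (2015) 241–433, doi:10.1561/2400000006 — §6.1 (pp. 300–301: (6.1),
  filled graph / monotone transitive extension, Theorem 6.1 citing [195, Lemma 4] =
  Rose–Tarjan–Lueker), §6.6 (p. 310: minimum orderings, the treewidth as
  `min_σ max_v deg⁺_*(v)`, citing [191, 39, 40]) (bib: VandenbergheAndersen2015; authors' copy
  checked, `lit` key `paper:url-1b9fdea6a8a3`, PDF pp. 64–65, 74).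
* [RTL76] D. J. Rose, R. E. Tarjan, G. S. Lueker, *Algorithmic aspects of vertex elimination on
  graphs*, SIAM J. Comput. 5 (1976) 266–283, doi:10.1137/0205021 — the fill-path lemma
  (Lemma 4 as cited at [VA15, p. 301]; Lemma 3, p. 10, of the report version held as `lit` key
  `paper:doi-10-1137-0205021`, text checked: "`{v,w}` is an edge of `G*_α` if and only if there
  exists a chain `[v = v₁, …, v_{k+1} = w]` in `G` with `α⁻¹(vᵢ) < min(α⁻¹(v), α⁻¹(w))`,
  `2 ≤ i ≤ k`").
* [Diestel] R. Diestel, *Graph Theory*, 4th ed., Springer 2010 — §12.3 Cor. 12.3.9 (bib: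
  Diestel2010; through `ChordalTreeDecomposition`).
-/

namespace Literature.Combinatorics.SimpleGraph

open Literature.LinearAlgebra.Matrix.ChordalSparsity

variable {V : Type*}

/-! ### The elimination graph -/

section ElimGraph

variable [LT V] {G G' H : _root_.SimpleGraph V}

/-- **THE ELIMINATION GRAPH (FILLED GRAPH, MONOTONE TRANSITIVE EXTENSION) `G*_σ`** of a graph on
an ordered vertex type: the least supergraph on the same vertices whose adjacency is monotone
transitive, i.e. in which every higher neighbourhood is complete ([VA15, §6.1]: "the higher
neighborhoods of all vertices in `(V, E*_σ, σ)` are complete … The elimination graph is also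
called the filled graph of `G_σ`, or its monotone transitive extension"). Defined here as the
infimum of all monotone transitive supergraphs; [VA15, (6.1)] constructs it by the elimination
game `E_i = E_{i-1} ∪ {{v,w} | v, w ≻ σ(i), {σ(i),v}, {σ(i),w} ∈ E_{i-1}}`, and Theorem 6.1
(`elimGraph_adj_iff` below) identifies the two. [cite: VandenbergheAndersen2015, §6.1 eq. (6.1)] -/
def elimGraph (G : _root_.SimpleGraph V) : _root_.SimpleGraph V :=
  sInf {H | G ≤ H ∧ MonotoneTransitive H.Adj}

/-- `G ⊆ G*_σ`. [cite: VandenbergheAndersen2015, §6.1 eq. (6.1)] -/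
theorem le_elimGraph : G ≤ elimGraph G :=
  le_sInf fun _ hH => hH.1

/-- Minimality: every monotone transitive supergraph contains the elimination graph.
[cite: VandenbergheAndersen2015, §6.1] -/
theorem elimGraph_le (hGH : G ≤ H) (hH : MonotoneTransitive H.Adj) : elimGraph G ≤ H :=
  sInf_le ⟨hGH, hH⟩

/-- The complete graph is monotone transitive. [folklore] -/
private theorem monotoneTransitive_top : MonotoneTransitive (⊤ : _root_.SimpleGraph V).Adj :=
  fun _ j k _ _ hjk _ _ => (SimpleGraph.top_adj j k).mpr hjk

/-- **The elimination graph is monotone transitive**: all its higher neighbourhoods are complete,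
so the order is a perfect elimination ordering for it ([VA15, §6.1, p. 301]).
[cite: VandenbergheAndersen2015, §6.1 (p. 301)] -/
theorem monotoneTransitive_elimGraph : MonotoneTransitive (elimGraph G).Adj := by
  intro i j k hij hik hjk hEij hEik
  rw [elimGraph, SimpleGraph.sInf_adj] at hEij hEik ⊢
  exact ⟨fun H hH => hH.2 hij hik hjk (hEij.1 H hH) (hEik.1 H hH), hjk⟩

/-- **Graph elimination adds no edge iff the order is a perfect elimination ordering**
([VA15, §6.1, p. 301]: "if `σ` is a perfect elimination ordering … graph elimination does not
add any edges and `G_σ = G*_σ`"). [cite: VandenbergheAndersen2015, §6.1 (p. 301)] -/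
theorem elimGraph_eq_self_iff : elimGraph G = G ↔ MonotoneTransitive G.Adj := by
  refine ⟨fun h => ?_, fun h => le_antisymm (elimGraph_le le_rfl h) le_elimGraph⟩
  rw [← h]
  exact monotoneTransitive_elimGraph

/-- Graph elimination is monotone in the graph. [cite: VandenbergheAndersen2015, §6.1] -/
theorem elimGraph_mono (h : G ≤ G') : elimGraph G ≤ elimGraph G' :=
  elimGraph_le (h.trans le_elimGraph) monotoneTransitive_elimGraph

/-- Graph elimination is idempotent. [cite: VandenbergheAndersen2015, §6.1] -/
theorem elimGraph_elimGraph : elimGraph (elimGraph G) = elimGraph G :=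
  elimGraph_eq_self_iff.mpr monotoneTransitive_elimGraph

end ElimGraph

/-- **The elimination graph is chordal** — "a chordal embedding or chordal extension of `G`"
([VA15, §6.1, p. 301]). [cite: VandenbergheAndersen2015, §6.1 (p. 301)] -/
theorem isChordal_elimGraph [LinearOrder V] {G : _root_.SimpleGraph V} : IsChordal (elimGraph G) :=
  isChordal_of_monotoneTransitive monotoneTransitive_elimGraph

/-! ### Theorem 6.1: fill edges = lower paths -/

section FillPath

variable [LinearOrder V] {G H : _root_.SimpleGraph V}

/-- A LOWER WALK from `v` to `w`: a walk of `G` all of whose vertices other than `v`, `w` precede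
both `v` and `w` ([VA15, Thm 6.1]: "a path `(v, z₁, …, z_k, w)` in `G` with interior vertices
that precede `v` and `w` in the ordering"; a lower walk contains a lower path, `Walk.bypass`).
[cite: VandenbergheAndersen2015, §6.1 Thm 6.1] -/
def LowerWalk (G : _root_.SimpleGraph V) (v w : V) : Prop :=
  ∃ p : G.Walk v w, ∀ z ∈ p.support, z = v ∨ z = w ∨ (z < v ∧ z < w)

/-- An edge is a lower walk. [cite: VandenbergheAndersen2015, §6.1 Thm 6.1] -/
theorem LowerWalk.of_adj {v w : V} (h : G.Adj v w) : LowerWalk G v w :=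
  ⟨h.toWalk, fun z hz => by
    rw [SimpleGraph.Walk.support_cons, SimpleGraph.Walk.support_nil, List.mem_cons,
      List.mem_singleton] at hz
    exact hz.imp_right Or.inl⟩

/-- Lower walks reverse. [cite: VandenbergheAndersen2015, §6.1 Thm 6.1] -/
theorem LowerWalk.symm {v w : V} (h : LowerWalk G v w) : LowerWalk G w v := by
  obtain ⟨p, hp⟩ := h
  refine ⟨p.reverse, fun z hz => ?_⟩
  rw [SimpleGraph.Walk.support_reverse, List.mem_reverse] at hz
  rcases hp z hz with h | h | h
  exacts [Or.inr (Or.inl h), Or.inl h, Or.inr (Or.inr ⟨h.2, h.1⟩)]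

/-- Two lower walks from a common LOWER vertex `i ≺ j, k` concatenate to a lower walk from `j`
to `k` — the monotone transitivity of the lower-walk relation.
[cite: VandenbergheAndersen2015, §6.1 Thm 6.1] -/
theorem LowerWalk.trans_of_lt {i j k : V} (hij : i < j) (hik : i < k) (h₁ : LowerWalk G i j)
    (h₂ : LowerWalk G i k) : LowerWalk G j k := by
  obtain ⟨p₁, hp₁⟩ := h₁
  obtain ⟨p₂, hp₂⟩ := h₂
  refine ⟨p₁.reverse.append p₂, fun z hz => ?_⟩
  rw [SimpleGraph.Walk.mem_support_append_iff, SimpleGraph.Walk.support_reverse,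
    List.mem_reverse] at hz
  rcases hz with hz | hz
  · rcases hp₁ z hz with h | h | h
    · exact Or.inr (Or.inr ⟨h ▸ hij, h ▸ hik⟩)
    · exact Or.inl h
    · exact Or.inr (Or.inr ⟨h.2, h.1.trans hik⟩)
  · rcases hp₂ z hz with h | h | h
    · exact Or.inr (Or.inr ⟨h ▸ hij, h ▸ hik⟩)
    · exact Or.inr (Or.inl h)
    · exact Or.inr (Or.inr ⟨h.1.trans hij, h.2⟩)

/-- THE LOWER-WALK GRAPH: `v ≠ w` joined by a lower walk. It is a monotone transitive supergraph
of `G`. [cite: VandenbergheAndersen2015, §6.1 Thm 6.1] -/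
def lowerWalkGraph (G : _root_.SimpleGraph V) : _root_.SimpleGraph V where
  Adj v w := v ≠ w ∧ LowerWalk G v w
  symm := ⟨fun v w (h : v ≠ w ∧ LowerWalk G v w) =>
    show w ≠ v ∧ LowerWalk G w v from ⟨h.1.symm, h.2.symm⟩⟩
  loopless := ⟨fun v (h : v ≠ v ∧ LowerWalk G v v) => h.1 rfl⟩

/-- Adjacency in the lower-walk graph. [cite: VandenbergheAndersen2015, §6.1 Thm 6.1] -/
theorem lowerWalkGraph_adj {v w : V} : (lowerWalkGraph G).Adj v w ↔ v ≠ w ∧ LowerWalk G v w :=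
  Iff.rfl

/-- `G` is a subgraph of its lower-walk graph. [cite: VandenbergheAndersen2015, §6.1 Thm 6.1] -/
theorem le_lowerWalkGraph : G ≤ lowerWalkGraph G :=
  fun _ _ h => lowerWalkGraph_adj.mpr ⟨h.ne, LowerWalk.of_adj h⟩

/-- The lower-walk graph is monotone transitive. [cite: VandenbergheAndersen2015, §6.1 Thm 6.1] -/
theorem monotoneTransitive_lowerWalkGraph : MonotoneTransitive (lowerWalkGraph G).Adj :=
  fun _ _ _ hij hik hjk h₁ h₂ => lowerWalkGraph_adj.mpr
    ⟨hjk, (lowerWalkGraph_adj.mp h₁).2.trans_of_lt hij hik (lowerWalkGraph_adj.mp h₂).2⟩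

/-- THE INDUCTION OF [VA15, Thm 6.1 "⇐"] / [RTL76, Lemma 4]: a lower PATH from `v` to `w ≠ v`
forces `{v, w}` into every monotone transitive supergraph `H ⊇ G` — split the path at its
HIGHEST interior vertex `x`; both halves are lower paths, so `{v,x}, {x,w} ∈ H` by induction,
and `x ≺ v, w` gives `{v,w} ∈ H` by monotone transitivity at `x`.
[cite: VandenbergheAndersen2015, §6.1 Thm 6.1] -/
theorem adj_of_isPath_lower (hGH : G ≤ H) (hH : MonotoneTransitive H.Adj) (n : ℕ) :
    ∀ {v w : V} (p : G.Walk v w), p.IsPath → p.length ≤ n →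
      (∀ z ∈ p.support, z = v ∨ z = w ∨ (z < v ∧ z < w)) → v ≠ w → H.Adj v w := by
  classical
  induction n with
  | zero =>
    intro v w p _ hlen _ hvw
    exact absurd (p.eq_of_length_eq_zero (Nat.le_zero.mp hlen)) hvw
  | succ n ih =>
    intro v w p hp hlen hz hvw
    by_cases hint : ∃ z ∈ p.support, z ≠ v ∧ z ≠ w
    · -- split at the highest interior vertex `x`
      obtain ⟨x, hxs, hxv, hxw, hxmax⟩ : ∃ x ∈ p.support, x ≠ v ∧ x ≠ w ∧
          ∀ z ∈ p.support, z ≠ v → z ≠ w → z ≤ x := by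
        set S := p.support.toFinset.filter fun z => z ≠ v ∧ z ≠ w with hS_def
        have hS : S.Nonempty := by
          obtain ⟨z, hzs, hzv, hzw⟩ := hint
          exact ⟨z, by simp [hS_def, hzs, hzv, hzw]⟩
        have hm := Finset.max'_mem S hS
        simp only [hS_def, Finset.mem_filter, List.mem_toFinset] at hm
        exact ⟨S.max' hS, hm.1, hm.2.1, hm.2.2,
          fun z hzs hzv hzw => Finset.le_max' S z (by simp [hS_def, hzs, hzv, hzw])⟩
      have hx : x < v ∧ x < w := by
        rcases hz x hxs with h | h | h
        exacts [absurd h hxv, absurd h hxw, h]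
      set q₁ := p.takeUntil x hxs with hq₁
      set q₂ := p.dropUntil x hxs with hq₂
      have hspec : q₁.append q₂ = p := p.take_spec hxs
      have hnodup : (q₁.support ++ q₂.support.tail).Nodup := by
        rw [← SimpleGraph.Walk.support_append, hspec]
        exact (SimpleGraph.Walk.isPath_def p).mp hp
      have hw₂ : w ∈ q₂.support.tail := by
        have h := q₂.end_mem_support
        rw [← SimpleGraph.Walk.cons_tail_support] at h
        exact (List.mem_cons.mp h).resolve_left (Ne.symm hxw)
      have hw₁ : w ∉ q₁.support := fun h => List.disjoint_of_nodup_append hnodup h hw₂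
      have hv₂ : v ∉ q₂.support.tail := fun h =>
        List.disjoint_of_nodup_append hnodup q₁.start_mem_support h
      -- both halves are lower paths
      have hz₁ : ∀ z ∈ q₁.support, z = v ∨ z = x ∨ (z < v ∧ z < x) := by
        intro z hzq
        have hzp : z ∈ p.support := p.support_takeUntil_subset_support hxs hzq
        by_cases hzv : z = v
        · exact Or.inl hzv
        by_cases hzx : z = x
        · exact Or.inr (Or.inl hzx)
        have hzw : z ≠ w := fun h => hw₁ (h ▸ hzq)
        rcases hz z hzp with h | h | h
        · exact absurd h hzv
        · exact absurd h hzw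
        · exact Or.inr (Or.inr ⟨h.1, lt_of_le_of_ne (hxmax z hzp hzv hzw) hzx⟩)
      have hz₂ : ∀ z ∈ q₂.support, z = x ∨ z = w ∨ (z < x ∧ z < w) := by
        intro z hzq
        have hzp : z ∈ p.support := p.support_dropUntil_subset_support hxs hzq
        by_cases hzx : z = x
        · exact Or.inl hzx
        by_cases hzw : z = w
        · exact Or.inr (Or.inl hzw)
        have hzv : z ≠ v := by
          intro h
          have hzt : z ∈ q₂.support.tail := by
            rw [← SimpleGraph.Walk.cons_tail_support] at hzq
            exact (List.mem_cons.mp hzq).resolve_left hzx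
          exact hv₂ (h ▸ hzt)
        rcases hz z hzp with h | h | h
        · exact absurd h hzv
        · exact absurd h hzw
        · exact Or.inr (Or.inr ⟨lt_of_le_of_ne (hxmax z hzp hzv hzw) hzx, h.2⟩)
      -- both halves are shorter
      have hlen₁ : q₁.length < p.length := SimpleGraph.Walk.length_takeUntil_lt_length hxs hxw
      have hlen₂ : q₂.length < p.length := by
        have h1 : p.length = q₁.length + q₂.length := by
          rw [← SimpleGraph.Walk.length_append, hspec]
        have h2 : q₁.length ≠ 0 := fun h0 => hxv (q₁.eq_of_length_eq_zero h0).symm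
        omega
      have h₁ : H.Adj v x := ih q₁ (hp.takeUntil hxs) (by omega) hz₁ (Ne.symm hxv)
      have h₂ : H.Adj x w := ih q₂ (hp.dropUntil hxs) (by omega) hz₂ hxw
      exact hH hx.1 hx.2 hvw h₁.symm h₂
    · -- no interior vertex: `p` is the single edge `vw`
      push Not at hint
      have hpos : 0 < p.length := by
        by_contra h0
        exact hvw (p.eq_of_length_eq_zero (by omega))
      have hadj : G.Adj v (p.getVert 1) := by
        have := p.adj_getVert_succ hpos
        rwa [SimpleGraph.Walk.getVert_zero] at this
      have h1 : p.getVert 1 = w := hint _ (p.getVert_mem_support 1) hadj.ne.symm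
      exact hGH (h1 ▸ hadj)

/-- A lower walk between distinct vertices forces the edge into every monotone transitive
supergraph. [cite: VandenbergheAndersen2015, §6.1 Thm 6.1] -/
theorem LowerWalk.adj_of_monotoneTransitive (hGH : G ≤ H) (hH : MonotoneTransitive H.Adj)
    {v w : V} (hvw : v ≠ w) (h : LowerWalk G v w) : H.Adj v w := by
  classical
  obtain ⟨p, hp⟩ := h
  exact adj_of_isPath_lower hGH hH _ p.bypass p.bypass_isPath le_rfl
    (fun z hz => hp z (p.support_bypass_subset_support hz)) hvw

/-- **[VA15, THEOREM 6.1] (Rose–Tarjan–Lueker 1976, Lemma 4): `{v,w}` is an edge of the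
elimination graph `G*_σ` if and only if `G` has a path from `v` to `w` whose interior vertices
all precede both `v` and `w`.** [cite: VandenbergheAndersen2015, §6.1 Thm 6.1] -/
theorem elimGraph_adj_iff {v w : V} : (elimGraph G).Adj v w ↔ v ≠ w ∧ LowerWalk G v w :=
  ⟨fun h => lowerWalkGraph_adj.mp
      (elimGraph_le le_lowerWalkGraph monotoneTransitive_lowerWalkGraph h),
    fun h => h.2.adj_of_monotoneTransitive le_elimGraph monotoneTransitive_elimGraph h.1⟩

/-- The elimination graph IS the lower-walk graph. [cite: VandenbergheAndersen2015, §6.1 Thm 6.1] -/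
theorem elimGraph_eq_lowerWalkGraph : elimGraph G = lowerWalkGraph G :=
  le_antisymm (elimGraph_le le_lowerWalkGraph monotoneTransitive_lowerWalkGraph)
    fun _ _ h => (elimGraph_adj_iff (G := G)).mpr (lowerWalkGraph_adj.mp h)

end FillPath


/-! ### §6.6: treewidth is the least elimination width -/

section ElimWidth

variable [LinearOrder V] [Fintype V] {G H : _root_.SimpleGraph V}

/-- **THE ELIMINATION WIDTH** of a graph on an ordered vertex type: the largest higher degree
`max_v deg⁺_*(v)` in the elimination graph `G*_σ` ("the size of the largest clique in the
triangulation or, equivalently, the maximum higher degree", [VA15, §6.6, p. 310]).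
[cite: VandenbergheAndersen2015, §6.6 (p. 310)] -/
noncomputable def elimWidth (G : _root_.SimpleGraph V) : ℕ :=
  Finset.univ.sup fun v => (higherAdj (elimGraph G).Adj v).ncard

/-- Every higher degree of the elimination graph is at most the elimination width.
[cite: VandenbergheAndersen2015, §6.6 (p. 310)] -/
theorem ncard_higherAdj_elimGraph_le_elimWidth (v : V) :
    (higherAdj (elimGraph G).Adj v).ncard ≤ elimWidth G :=
  Finset.le_sup (f := fun v => (higherAdj (elimGraph G).Adj v).ncard) (Finset.mem_univ v)

/-- **`tw(G) ≤` the elimination width of every ordering** — the bags `col_*(v)` of the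
elimination graph form a tree decomposition of `G` (`elimTreeDecomposition` of
`ChordalTreeDecomposition`). [cite: VandenbergheAndersen2015, §6.6 (p. 310)] -/
theorem treewidth_le_elimWidth : treewidth G ≤ elimWidth G :=
  treewidth_le_of_forall_ncard_higherAdj_le le_elimGraph monotoneTransitive_elimGraph
    ncard_higherAdj_elimGraph_le_elimWidth

/-- In a perfect elimination ordering of a supergraph `H ⊇ G`, the elimination width of `G` is at
most `ω(H) - 1`: `G*_σ ⊆ H`, and `col_H(v)` is a clique of `H` with `deg⁺_H(v) + 1` vertices.
[cite: VandenbergheAndersen2015, §6.6 (p. 310)] -/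
theorem elimWidth_lt_cliqueNum_of_le [Nonempty V] (hGH : G ≤ H) (hH : MonotoneTransitive H.Adj) :
    elimWidth G < H.cliqueNum := by
  classical
  have hle : elimGraph G ≤ H := elimGraph_le hGH hH
  have hpos : 0 < H.cliqueNum :=
    SimpleGraph.IsClique.card_le_cliqueNum (t := {Classical.arbitrary V}) (tc := by simp)
  refine (Finset.sup_lt_iff hpos).mpr fun v _ => ?_
  have hsub : higherAdj (elimGraph G).Adj v ⊆ higherAdj H.Adj v := fun u hu => by
    rw [mem_higherAdj_iff] at hu ⊢
    exact ⟨hu.1, hle hu.2⟩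
  have hfin : (higherAdj H.Adj v).Finite := Set.toFinite _
  calc (higherAdj (elimGraph G).Adj v).ncard
      ≤ (higherAdj H.Adj v).ncard := Set.ncard_le_ncard hsub hfin
    _ < (clique H.Adj v).ncard := by
        rw [clique_eq_insert_higherAdj,
          Set.ncard_insert_of_notMem (not_mem_higherAdj_self H.Adj v) hfin]
        omega
    _ ≤ H.cliqueNum := by
        rw [Set.ncard_eq_toFinset_card _ (Set.toFinite _)]
        exact SimpleGraph.IsClique.card_le_cliqueNum (tc := by
          rw [Set.Finite.coe_toFinset]
          exact fun a ha b hb hab => clique_complete (fun _ _ h => h.symm) hH v ha hb hab)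

/-- For a perfect elimination ordering of `G` itself the elimination width is `ω(G) - 1 = tw(G)`.
[cite: VandenbergheAndersen2015, §6.6 (p. 310)] -/
theorem elimWidth_eq_treewidth_of_monotoneTransitive [Nonempty V] (hG : MonotoneTransitive G.Adj) :
    elimWidth G = treewidth G := by
  refine le_antisymm ?_ treewidth_le_elimWidth
  have h1 := elimWidth_lt_cliqueNum_of_le le_rfl hG
  have h2 := treewidth_add_one_eq_cliqueNum_of_monotoneTransitive hG
  omega

end ElimWidth

section MinWidth

variable [Fintype V] (G : _root_.SimpleGraph V) {H : _root_.SimpleGraph V}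

/-- **Every chordal supergraph contains an elimination graph**: for a perfect elimination
ordering `σ` of a chordal `H ⊇ G`, `G*_σ ⊆ H` (so the minimal chordal extensions are elimination
graphs, [VA15, §6.6]; not every chordal extension is one). [cite: VandenbergheAndersen2015, §6.6] -/
theorem IsChordal.exists_linearOrder_elimGraph_le (hH : IsChordal H) (hGH : G ≤ H) :
    ∃ o : LinearOrder V, @elimGraph V o.toLT G ≤ H := by
  obtain ⟨o, hEm⟩ := isChordal_iff_exists_linearOrder_monotoneTransitive'.mp hH
  exact ⟨o, @elimGraph_le V o.toLT G H hGH hEm⟩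

/-- **SOME ORDERING HAS ELIMINATION WIDTH `tw(G)`** — a perfect elimination ordering of a chordal
supergraph `H ⊇ G` with `ω(H) - 1 = tw(G)` (`exists_le_isChordal_cliqueNum_eq_treewidth_add_one`
of `ChordalTreeDecomposition`, [Diestel, Cor. 12.3.9]).
[cite: VandenbergheAndersen2015, §6.6 (p. 310)] -/
theorem exists_linearOrder_elimWidth_eq_treewidth [Nonempty V] :
    ∃ o : LinearOrder V, @elimWidth V o _ G = treewidth G := by
  obtain ⟨H, hGH, hH, hω⟩ := exists_le_isChordal_cliqueNum_eq_treewidth_add_one (G := G)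
  obtain ⟨o, hEm⟩ := isChordal_iff_exists_linearOrder_monotoneTransitive'.mp hH
  letI : LinearOrder V := o
  refine ⟨o, le_antisymm ?_ treewidth_le_elimWidth⟩
  have := elimWidth_lt_cliqueNum_of_le hGH hEm
  omega

/-- **[VA15, §6.6, p. 310]: THE TREEWIDTH IS THE MINIMUM, OVER ALL ORDERINGS, OF THE LARGEST
HIGHER DEGREE IN THE ELIMINATION GRAPH** ("The minimum value of this quantity, over all possible
orderings, is known as the treewidth of `G`"). [cite: VandenbergheAndersen2015, §6.6 (p. 310)] -/
theorem isLeast_treewidth_elimWidth [Nonempty V] :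
    IsLeast {w : ℕ | ∃ o : LinearOrder V, @elimWidth V o _ G = w} (treewidth G) :=
  ⟨exists_linearOrder_elimWidth_eq_treewidth G, fun _ ⟨o, hw⟩ =>
    hw ▸ @treewidth_le_elimWidth V o _ G⟩

end MinWidth

end Literature.Combinatorics.SimpleGraph
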